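import Literature.Probability.RandomPlanarGeometry.SAWWordsZd
import HarnessLib

/-!
# Counting words over `Fin d × Bool` that survive a pruning automaton (Collatz–Wielandt bound)

Topic `Literature/Probability/RandomPlanarGeometry` (continues `SAWWordsZd.lean`; the `d`-dimensional twin of `SAWWordAutomata.lean`).
The abstract counting lemma behind the finite-memory upper bounds for the connective constant (Pönitz–Tittmann 2000; Alm 1993): a
deterministic automaton reads a step word letter by letter, its state after the word `w` being `run step w : Option State` (`none` =
the word was killed).  If `R` is a set of states containing the initial state `[]` and closed under the transitions, and `v : State → ℕ`,
`v ≥ 1` on `R`, satisfies the SUB-INVARIANCE (Collatz–Wielandt) inequality `D · Σ_a v(step s a) ≤ N · v(s)` on `R`, then the number of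
surviving words of length `n` is at most `(N/D)ⁿ v([])` (`card_liveWords_mul_pow_le`).  States are step words (`List (Fin d × Bool)`)
throughout (the automata we use remember a suffix of the input).

## Contents (namespace `Literature.Probability.RandomPlanarGeometry.SAW.Zd.WordAutomaton`)

* `words_succ`, `sum_words_succ` (`Σ_{|w|=n+1} f w = Σ_{|w|=n} Σ_a f (w ++ [a])`);
* `run step w`, `liveWords step n`, `Certificate step R v N D`, `weightSum`, and the bounds
  `card_liveWords_mul_pow_le : #(liveWords n) · Dⁿ ≤ Nⁿ · v []`, `count_mul_pow_le : cₙ · Dⁿ ≤ Nⁿ · v []` (if every self-avoiding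
  word survives).

References: A. Pönitz, P. Tittmann, Electron. J. Combin. 7 (2000) R21, §3 [PonitzTittmann2000]; S. E. Alm, Combin. Probab. Comput. 2
(1993) 115–136; L. Collatz, Math. Z. 48 (1942) 221–226.
-/

open Finset
open scoped BigOperators

namespace Literature.Probability.RandomPlanarGeometry.SAW.Zd

variable {d : ℕ}

/-! ### Splitting off the last letter of a word -/

/-- `words d (n+1)` is obtained from `words d n` by appending one letter. [cite: PonitzTittmann2000, §3] -/
theorem Word.words_succ (d n : ℕ) :
    Word.words d (n + 1) = (Word.words d n).biUnion fun w => (univ : Finset (Fin d × Bool)).image fun a => w ++ [a] := by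
  ext w
  simp only [Word.mem_words, mem_biUnion, mem_image, mem_univ, true_and]
  constructor
  · intro h
    refine ⟨w.take n, by simp [h], w[n]'(by omega), ?_⟩
    conv_rhs => rw [← List.take_append_drop n w]
    rw [List.drop_eq_getElem_cons (by omega), List.drop_of_length_le (by omega)]
  · rintro ⟨w', hw', a, rfl⟩
    simp [hw']

/-- **Last-letter decomposition of sums over words**: `Σ_{|w| = n+1} f(w) = Σ_{|w| = n} Σ_a f(w ++ [a])`. [cite: PonitzTittmann2000, §3] -/
theorem Word.sum_words_succ {M : Type*} [AddCommMonoid M] (d n : ℕ) (f : List (Fin d × Bool) → M) :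
    ∑ w ∈ Word.words d (n + 1), f w = ∑ w ∈ Word.words d n, ∑ a : Fin d × Bool, f (w ++ [a]) := by
  rw [Word.words_succ, sum_biUnion]
  · refine sum_congr rfl fun w _ => ?_
    rw [sum_image]
    intro a _ a' _ h
    simpa using List.append_cancel_left h
  · intro w _ w' _ hne
    simp only [Function.onFun]
    rw [Finset.disjoint_left]
    intro u hu hu'
    simp only [mem_image, mem_univ, true_and] at hu hu'
    obtain ⟨a, rfl⟩ := hu
    obtain ⟨a', h⟩ := hu'
    have := congrArg List.dropLast h
    simp only [List.dropLast_concat] at this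
    exact hne this.symm

namespace WordAutomaton

variable (step : List (Fin d × Bool) → Fin d × Bool → Option (List (Fin d × Bool)))

/-! ### Runs -/

/-- The state of the automaton `step` after reading `w` from the initial state `[]` (`none` if the word was killed on the way).
[cite: PonitzTittmann2000, §2] -/
def run (w : List (Fin d × Bool)) : Option (List (Fin d × Bool)) :=
  w.foldl (fun o a => o.bind fun s => step s a) (some [])

/-- The run on the empty word is the initial state. [cite: PonitzTittmann2000, §3] -/
@[simp] theorem run_nil : run step [] = some [] := rfl

/-- Reading one more letter. [cite: PonitzTittmann2000, §3] -/
theorem run_append_singleton (w : List (Fin d × Bool)) (a : Fin d × Bool) :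
    run step (w ++ [a]) = (run step w).bind fun s => step s a := by
  simp [run, List.foldl_append]

/-- The words of length `n` that survive the automaton. [cite: PonitzTittmann2000, §3] -/
def liveWords (n : ℕ) : Finset (List (Fin d × Bool)) := (Word.words d n).filter fun w => run step w ≠ none

/-- Membership in `liveWords`. [cite: PonitzTittmann2000, §3] -/
@[simp] theorem mem_liveWords {n : ℕ} {w : List (Fin d × Bool)} :
    w ∈ liveWords step n ↔ w.length = n ∧ run step w ≠ none := by
  simp [liveWords]

/-! ### Certificates and the weighted count -/

/-- A **Collatz–Wielandt certificate** for the automaton `step` with ratio `N/D`: a set of states `R ∋ []` closed under the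
transitions and a weight `v ≥ 1` on `R` with `D · Σ_a v(step s a) ≤ N · v s` for `s ∈ R`. [cite: PonitzTittmann2000, §3] -/
structure Certificate (R : Set (List (Fin d × Bool))) (v : List (Fin d × Bool) → ℕ) (N D : ℕ) : Prop where
  /-- the initial state is in `R` -/
  nil_mem : [] ∈ R
  /-- `R` is closed under the transitions -/
  closed : ∀ s ∈ R, ∀ a b, step s a = some b → b ∈ R
  /-- the weight is positive on `R` -/
  one_le : ∀ s ∈ R, 1 ≤ v s
  /-- sub-invariance of the weight -/
  subinv : ∀ s ∈ R, D * ∑ a : Fin d × Bool, ((step s a).map v).getD 0 ≤ N * v s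

variable {step}

/-- The weight of an optional state (`0` for a killed run). [folklore] -/
def phi (v : List (Fin d × Bool) → ℕ) : Option (List (Fin d × Bool)) → ℕ
  | none => 0
  | some s => v s

/-- `phi v (some s) = v s`. [cite: PonitzTittmann2000, §3] -/
@[simp] theorem phi_some (v : List (Fin d × Bool) → ℕ) (s : List (Fin d × Bool)) : phi v (some s) = v s := rfl

/-- `phi v none = 0`. [cite: PonitzTittmann2000, §3] -/
@[simp] theorem phi_none (v : List (Fin d × Bool) → ℕ) : phi v none = 0 := rfl

/-- `phi` as `Option.map`/`getD`. [cite: PonitzTittmann2000, §3] -/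
theorem phi_eq_getD (v : List (Fin d × Bool) → ℕ) (o : Option (List (Fin d × Bool))) : phi v o = (o.map v).getD 0 := by
  cases o <;> rfl

/-- The total weight `Φₙ = Σ_{|w| = n} v(run w)` of the runs of length `n`. [cite: PonitzTittmann2000, §3] -/
def weightSum (step : List (Fin d × Bool) → Fin d × Bool → Option (List (Fin d × Bool))) (v : List (Fin d × Bool) → ℕ) (n : ℕ) : ℕ :=
  ∑ w ∈ Word.words d n, phi v (run step w)

/-- `Φ₀ = v([])`. [cite: PonitzTittmann2000, §3] -/
theorem weightSum_zero (v : List (Fin d × Bool) → ℕ) : weightSum step v 0 = v [] := by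
  simp [weightSum, Word.words]

/-- Surviving runs stay in the closed set `R`. [cite: PonitzTittmann2000, §3] -/
theorem run_mem {R : Set (List (Fin d × Bool))} {v : List (Fin d × Bool) → ℕ} {N D : ℕ} (hc : Certificate step R v N D)
    (w : List (Fin d × Bool)) {s : List (Fin d × Bool)} (h : run step w = some s) : s ∈ R := by
  induction w using List.reverseRecOn generalizing s with
  | nil => simp only [run_nil, Option.some.injEq] at h; subst h; exact hc.nil_mem
  | append_singleton w a ih =>
    rw [run_append_singleton] at h
    cases hw : run step w with
    | none => simp [hw] at h
    | some s' => rw [hw, Option.bind_some] at h; exact hc.closed s' (ih hw) a s h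

/-- **One step of the weighted count**: `D · Φₙ₊₁ ≤ N · Φₙ`. [cite: PonitzTittmann2000, §3] -/
theorem mul_weightSum_succ_le {R : Set (List (Fin d × Bool))} {v : List (Fin d × Bool) → ℕ} {N D : ℕ}
    (hc : Certificate step R v N D) (n : ℕ) :
    D * weightSum step v (n + 1) ≤ N * weightSum step v n := by
  rw [weightSum, weightSum, Word.sum_words_succ, mul_sum, mul_sum]
  refine sum_le_sum fun w _ => ?_
  cases hw : run step w with
  | none => simp [run_append_singleton, hw]
  | some s =>
    have hs : s ∈ R := run_mem hc w hw
    simp only [run_append_singleton, hw, Option.bind_some, phi_eq_getD]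
    exact hc.subinv s hs

/-- **`Dⁿ Φₙ ≤ Nⁿ v([])`**. [cite: PonitzTittmann2000, §3] -/
theorem pow_mul_weightSum_le {R : Set (List (Fin d × Bool))} {v : List (Fin d × Bool) → ℕ} {N D : ℕ}
    (hc : Certificate step R v N D) (n : ℕ) :
    D ^ n * weightSum step v n ≤ N ^ n * v [] := by
  induction n with
  | zero => simp [weightSum_zero]
  | succ n ih =>
    calc D ^ (n + 1) * weightSum step v (n + 1)
        = D ^ n * (D * weightSum step v (n + 1)) := by ring
      _ ≤ D ^ n * (N * weightSum step v n) := Nat.mul_le_mul_left _ (mul_weightSum_succ_le hc n)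
      _ = N * (D ^ n * weightSum step v n) := by ring
      _ ≤ N * (N ^ n * v []) := Nat.mul_le_mul_left _ ih
      _ = N ^ (n + 1) * v [] := by ring

/-- The number of surviving words is at most the weighted count. [cite: PonitzTittmann2000, §3] -/
theorem card_liveWords_le_weightSum {R : Set (List (Fin d × Bool))} {v : List (Fin d × Bool) → ℕ} {N D : ℕ}
    (hc : Certificate step R v N D) (n : ℕ) :
    (liveWords step n).card ≤ weightSum step v n := by
  rw [liveWords, card_eq_sum_ones, sum_filter, weightSum]
  refine sum_le_sum fun w _ => ?_
  split_ifs with h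
  · cases hw : run step w with
    | none => exact absurd hw h
    | some s => exact hc.one_le s (run_mem hc w hw)
  · exact Nat.zero_le _

/-- **Collatz–Wielandt bound for the surviving words**: `#(liveWords n) · Dⁿ ≤ Nⁿ · v([])`. [cite: PonitzTittmann2000, §3] -/
theorem card_liveWords_mul_pow_le {R : Set (List (Fin d × Bool))} {v : List (Fin d × Bool) → ℕ} {N D : ℕ}
    (hc : Certificate step R v N D) (n : ℕ) :
    (liveWords step n).card * D ^ n ≤ N ^ n * v [] :=
  calc (liveWords step n).card * D ^ n ≤ weightSum step v n * D ^ n :=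
        Nat.mul_le_mul_right _ (card_liveWords_le_weightSum hc n)
    _ = D ^ n * weightSum step v n := mul_comm _ _
    _ ≤ N ^ n * v [] := pow_mul_weightSum_le hc n

/-- If every self-avoiding word survives, `cₙ · Dⁿ ≤ Nⁿ · v([])` (`cₙ = SAW.Zd.count d n`). [cite: PonitzTittmann2000, §3] -/
theorem count_mul_pow_le {R : Set (List (Fin d × Bool))} {v : List (Fin d × Bool) → ℕ} {N D : ℕ}
    (hc : Certificate step R v N D) (hsaw : ∀ w, Word.IsSAW w → run step w ≠ none) (n : ℕ) :
    count d n * D ^ n ≤ N ^ n * v [] := by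
  refine le_trans (Nat.mul_le_mul_right _ ?_) (card_liveWords_mul_pow_le hc n)
  rw [← Word.card_sawWords]
  refine card_le_card fun w hw => ?_
  rw [Word.mem_sawWords] at hw
  exact (mem_liveWords step).2 ⟨hw.1, hsaw w hw.2⟩

end WordAutomaton

end Literature.Probability.RandomPlanarGeometry.SAW.Zd
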